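import Mathlib
import Summits.Ventures.HodgeRepro.LitRank
import Summits.Ventures.HodgeRepro.LitRankChar
import Summits.Ventures.HodgeRepro.LitRankCyclic
import Summits.Ventures.HodgeRepro.LitRankBound
import Summits.Ventures.HodgeRepro.LitRankRestrict

/-!
# LitRankYanai — Yanai's Theorem: a simple CM-type of prime dimension is nondegenerate

Blind cell `pub-hodge-repro`, seat lit-2 (gen 3).  Companion of `LitRank.lean` (same seat); uses
`LitRankChar` / `LitRankCyclic` (Kubota's Lemma 2 and Yanai's cyclic Lemma, conditional on Kubota's
character formula), `LitRankBound` (`rank ≤ d + 1`) and `LitRankRestrict` (Tankeev's inequality,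
rank through right translates).

**Source.** H. Yanai, *On the rank of CM-type*, Nagoya Math. J. 97 (1985) 169–172 (store
`paper:doi-10-1017-s0027763000021292`): Theorem, p.171 (store p0003:L24–26): "Let (K,S) be a
simple CM-type of dimension d.  If d is a prime, then (K,S) is non-degenerate."  = Dodson 1987
Thm 1.0 (v) (Ribet's nondegeneracy theorem).  Typed in `LitRank.lean` as the named fact
`Yanai1985_theorem_prime_nondegenerate`; discharged here as
`Yanai1985_theorem_prime_nondegenerate_of_charFormula` (conditional on
`Kubota_rank_abelian_charFormula`, proved by seat typer-2 in `KubotaLit2.lean`), and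
unconditionally in `LitRankHolds.lean`.

**Architecture (Yanai p.171–172, store p0003:L27–30, p0004:L1–14), mirrored lemma by lemma.**
1. `[G : H] = 2d` and `d ∣ |G|` (`index_eq_two_mul_dim`, `dim_dvd_card`).
2. Cauchy: an element `g₀` of order `d`; when `H` has trivial normal core a conjugate lies outside
   `H` (`exists_orderOf_eq_dim_notMem_H`).  Yanai has `G = Gal(L/ℚ)` acting faithfully on `H\G`;
   abstract triples need not be faithful, so §6 quotients by `normalCore H` first
   (`quotientTriple`: rank, dimension and simplicity are unchanged, and the quotient is faithful).
3. `G₀ = ⟨ρ g₀⟩` is cyclic of order `2d` (`d` odd), contains `ρ`, meets `H` trivially, and is a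
   transversal of `H\G` (`orderOf_ρ_mul`, `ρ_mem_zpowers`, `zpowers_inf_H_eq_bot`,
   `exists_mul_eq_of_inf_eq_bot`).
4. The restricted type `(G₀, 1, S ∩ G₀)` is simple unless `S ∩ G₀ ∈ {⟨g₀⟩, ⟨g₀⟩ρ}`
   (`isSimple_of_not_smul_eq`, `S_eq_zpowers_or_of_smul_eq`); in the exceptional case a Galois
   conjugate `S g ∉ {S, Sρ}` (exists since `rank ≥ 3`, `three_le_rank_of_isSimple`) has the same
   rank (Prop. A (b), `rank_rightTranslate`) and is non-exceptional (`isNondegenerate_of_exc`).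
5. Yanai's Lemma (cyclic case) gives `rank(G₀, 1, S ∩ G₀) = d + 1`; Prop. B (Tankeev,
   `rank_restrict_le`) and Prop. A (c) (`rank_le_dim_add_one`) give `d + 1 ≤ rank ≤ d + 1`
   (`isNondegenerate_of_not_exc`).
6. `d = 2`: `3 ≤ rank ≤ d + 1 = 3` (`isNondegenerate_of_isSimple_of_prime_of_core`).

No new named fact is introduced (D-0026); every intermediate result is proved inline.

SPLIT NOTE (gen 4): this is part 1 of 4 of the former single file `LitRankYanai.lean` (split at the ≤ 400-line rule; text of every declaration unchanged); the later parts are `LitRankYanai2`, `LitRankYanai3`, `LitRankYanai`.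
-/

open Finset
open scoped Pointwise

namespace HodgeRepro.Lit2

/-! ## §1–3  Index, Cauchy, the cyclic transversal -/

namespace CMTriple

variable {G : Type*} [Group G] [Fintype G] [DecidableEq G] (T : CMTriple G)

/-! ### The index is `2d` -/

omit [DecidableEq G] in
/-- `[G : H] = 2 d`: the cosets come in the pairs `{gH, ρ g H}` (fixed-point-free involution). -/
theorem index_eq_two_mul_dim : T.H.index = 2 * T.dim := by
  classical
  let Q := G ⧸ T.H
  let σ : Q → Q := fun q => T.ρ • q
  have hσσ : ∀ q, σ (σ q) = q := fun q => by
    simp only [σ, smul_smul, T.ρ_mul_self, one_smul]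
  have hσne : ∀ q, σ q ≠ q := by
    intro q
    induction q using QuotientGroup.induction_on with
    | H a =>
      intro h
      have h' : ((T.ρ * a : G) : Q) = (a : Q) := h
      rw [QuotientGroup.eq] at h'
      apply T.ρ_notMem_H
      have hinv : T.ρ⁻¹ = T.ρ := by rw [inv_eq_iff_mul_eq_one, T.ρ_mul_self]
      have : (T.ρ * a)⁻¹ * a = T.ρ := by
        rw [_root_.mul_inv_rev, mul_assoc, hinv, T.ρ_comm a, inv_mul_cancel_left]
      rwa [this] at h'
  letI : LinearOrder Q := LinearOrder.lift' (Fintype.equivFin Q) (Fintype.equivFin Q).injective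
  let A : Finset Q := univ.filter fun q => q < σ q
  let B : Finset Q := univ.filter fun q => σ q < q
  have hσinj : Function.Injective σ := Function.LeftInverse.injective hσσ
  have hAB : A.image σ = B := by
    ext q
    simp only [A, B, Finset.mem_image, Finset.mem_filter, Finset.mem_univ, true_and]
    constructor
    · rintro ⟨p, hp, rfl⟩
      rwa [hσσ]
    · intro hq
      exact ⟨σ q, by rwa [hσσ], hσσ q⟩
  have hcardAB : A.card = B.card := by
    rw [← hAB, Finset.card_image_of_injective _ hσinj]
  have hunion : A ∪ B = univ := by
    ext q
    simp only [A, B, Finset.mem_union, Finset.mem_filter, Finset.mem_univ, true_and, iff_true]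
    rcases lt_or_gt_of_ne (hσne q) with h | h
    · exact Or.inr h
    · exact Or.inl h
  have hdisj : Disjoint A B := by
    rw [Finset.disjoint_left]
    intro q hqA hqB
    simp only [A, B, Finset.mem_filter, Finset.mem_univ, true_and] at hqA hqB
    exact lt_asymm hqA hqB
  have hcardQ : 2 * A.card = Fintype.card Q := by
    rw [← Finset.card_univ, ← hunion, Finset.card_union_of_disjoint hdisj, hcardAB]
    ring
  unfold dim
  rw [Subgroup.index_eq_card, Nat.card_eq_fintype_card, ← hcardQ]
  omega

omit [DecidableEq G] in
/-- `d ∣ |G|`. -/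
theorem dim_dvd_card : T.dim ∣ Fintype.card G := by
  have h := T.H.index_mul_card
  rw [T.index_eq_two_mul_dim, Nat.card_eq_fintype_card (α := G)] at h
  exact ⟨2 * Nat.card T.H, by rw [← h]; ring⟩

/-! ### An element of prime order `d` outside `H` (faithful case) -/

omit [DecidableEq G] in
/-- If `H` has trivial normal core (the action on `H\G` is faithful) and `d` is prime, some
element of order `d` lies outside `H`: Cauchy gives `x` of order `d`, and `x ∉ normalCore H = ⊥`
gives a conjugate `b x b⁻¹ ∉ H`. -/
theorem exists_orderOf_eq_dim_notMem_H (hcore : T.H.normalCore = ⊥) (hd : T.dim.Prime) :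
    ∃ g : G, orderOf g = T.dim ∧ g ∉ T.H := by
  haveI : Fact T.dim.Prime := ⟨hd⟩
  obtain ⟨x, hx⟩ := exists_prime_orderOf_dvd_card T.dim T.dim_dvd_card
  have hx1 : x ≠ 1 := by
    intro h; rw [h, orderOf_one] at hx; exact hd.one_lt.ne hx
  have hxcore : x ∉ T.H.normalCore := by
    rw [hcore, Subgroup.mem_bot]; exact hx1
  have : ¬ ∀ b : G, b * x * b⁻¹ ∈ T.H := hxcore
  obtain ⟨b, hb⟩ := not_forall.mp this
  refine ⟨b * x * b⁻¹, ?_, hb⟩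
  rw [← MulAut.conj_apply, MulEquiv.orderOf_eq, hx]

/-! ### The cyclic transversal `C = ⟨ρ g₀⟩` -/

section Transversal

omit [Fintype G] [DecidableEq G] in
/-- `ρ` commutes with every `g` (`Commute` form of `ρ_comm`). -/
theorem commute_ρ (g : G) : Commute T.ρ g := T.ρ_comm g

omit [Fintype G] [DecidableEq G] in
/-- `ρ` has order `2`. -/
theorem orderOf_ρ : orderOf T.ρ = 2 := by
  have h2 : T.ρ ^ 2 = 1 := by rw [sq, T.ρ_mul_self]
  exact orderOf_eq_prime h2 T.ρ_ne_one

omit [Fintype G] [DecidableEq G] in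
/-- `ρ ^ k = 1` for `k` even, `= ρ` for `k` odd. -/
theorem ρ_pow_even {k : ℕ} (hk : Even k) : T.ρ ^ k = 1 := by
  obtain ⟨m, rfl⟩ := hk
  rw [← two_mul, pow_mul, sq, T.ρ_mul_self, one_pow]

omit [Fintype G] [DecidableEq G] in
/-- `ρ ^ k = ρ` for `k` odd. -/
theorem ρ_pow_odd {k : ℕ} (hk : Odd k) : T.ρ ^ k = T.ρ := by
  obtain ⟨m, rfl⟩ := hk
  rw [pow_succ, pow_mul, sq, T.ρ_mul_self, one_pow, one_mul]

variable {g₀ : G}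

omit [Fintype G] [DecidableEq G] in
/-- `ρ g₀` has order `2d` when `g₀` has odd prime order `d` (`ρ` central of order `2`). -/
theorem orderOf_ρ_mul (hg : orderOf g₀ = T.dim) (hd : T.dim.Prime) (hd2 : T.dim ≠ 2) :
    orderOf (T.ρ * g₀) = 2 * T.dim := by
  rw [(T.commute_ρ g₀).orderOf_mul_eq_mul_orderOf_of_coprime, T.orderOf_ρ, hg]
  rw [T.orderOf_ρ, hg]
  exact (Nat.coprime_primes Nat.prime_two hd).mpr (Ne.symm hd2)

omit [Fintype G] [DecidableEq G] in
/-- `ρ = (ρ g₀)^d ∈ ⟨ρ g₀⟩` (`d` odd). -/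
theorem ρ_mem_zpowers (hg : orderOf g₀ = T.dim) (hd : T.dim.Prime) (hd2 : T.dim ≠ 2) :
    T.ρ ∈ Subgroup.zpowers (T.ρ * g₀) := by
  have hodd : Odd T.dim := hd.eq_two_or_odd'.resolve_left hd2
  refine ⟨(T.dim : ℤ), ?_⟩
  show (T.ρ * g₀) ^ (T.dim : ℤ) = T.ρ
  rw [zpow_natCast, (T.commute_ρ g₀).mul_pow, ← hg, pow_orderOf_eq_one, mul_one, hg,
    T.ρ_pow_odd hodd]

omit [DecidableEq G] in
/-- `⟨g₀⟩ ∩ H = 1`: `⟨g₀⟩` has prime order and `g₀ ∉ H`. -/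
theorem pow_mem_H_iff (hg : orderOf g₀ = T.dim) (hgH : g₀ ∉ T.H) (hd : T.dim.Prime) (k : ℕ) :
    g₀ ^ k ∈ T.H ↔ g₀ ^ k = 1 := by
  constructor
  · intro hk
    by_contra hne
    have hdvd : ¬ orderOf g₀ ∣ k := by rwa [orderOf_dvd_iff_pow_eq_one]
    have hcop : (orderOf g₀).Coprime k := by
      rw [hg] at hdvd ⊢
      exact (Nat.Prime.coprime_iff_not_dvd hd).mpr hdvd
    -- `⟨g₀ ^ k⟩ = ⟨g₀⟩` (same order), and `⟨g₀ ^ k⟩ ≤ H`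
    have hle : Subgroup.zpowers (g₀ ^ k) ≤ Subgroup.zpowers g₀ :=
      Subgroup.zpowers_le.mpr (Subgroup.npow_mem_zpowers g₀ k)
    have heq : Subgroup.zpowers (g₀ ^ k) = Subgroup.zpowers g₀ :=
      Subgroup.eq_of_le_of_card_ge hle (by rw [Nat.card_zpowers, Nat.card_zpowers, hcop.orderOf_pow])
    have : g₀ ∈ Subgroup.zpowers (g₀ ^ k) := heq ▸ Subgroup.mem_zpowers g₀
    exact hgH (Subgroup.zpowers_le.mpr hk this)
  · intro h; rw [h]; exact T.H.one_mem

omit [DecidableEq G] in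
/-- `⟨ρ g₀⟩ ∩ H = 1`. -/
theorem zpowers_inf_H_eq_bot (hg : orderOf g₀ = T.dim) (hgH : g₀ ∉ T.H) (hd : T.dim.Prime)
    (hd2 : T.dim ≠ 2) : Subgroup.zpowers (T.ρ * g₀) ⊓ T.H = ⊥ := by
  rw [eq_bot_iff]
  intro c hc
  rw [Subgroup.mem_inf] at hc
  obtain ⟨hcz, hcH⟩ := hc
  rw [← mem_powers_iff_mem_zpowers, Submonoid.mem_powers_iff] at hcz
  obtain ⟨k, rfl⟩ := hcz
  rw [Subgroup.mem_bot]
  rw [(T.commute_ρ g₀).mul_pow] at hcH ⊢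
  have hρ2k : T.ρ ^ (2 * k) = 1 := T.ρ_pow_even (even_two_mul k)
  -- the square lies in `⟨g₀⟩ ∩ H = 1`
  have hsq : (T.ρ ^ k * g₀ ^ k) ^ 2 ∈ T.H := T.H.pow_mem hcH 2
  have hsq' : (T.ρ ^ k * g₀ ^ k) ^ 2 = g₀ ^ (2 * k) := by
    rw [((T.commute_ρ g₀).pow_pow k k).mul_pow, ← pow_mul, ← pow_mul, mul_comm k 2, hρ2k, one_mul]
  rw [hsq', T.pow_mem_H_iff hg hgH hd, ← orderOf_dvd_iff_pow_eq_one, hg] at hsq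
  have hdk : T.dim ∣ k := by
    have hcop : Nat.Coprime T.dim 2 := (Nat.coprime_primes hd Nat.prime_two).mpr hd2
    exact hcop.dvd_of_dvd_mul_left hsq
  have hg0k : g₀ ^ k = 1 := by rw [← orderOf_dvd_iff_pow_eq_one, hg]; exact hdk
  rw [hg0k, mul_one] at hcH ⊢
  rcases Nat.even_or_odd k with hk | hk
  · exact T.ρ_pow_even hk
  · exfalso
    apply T.ρ_notMem_H
    rwa [T.ρ_pow_odd hk] at hcH

end Transversal

end CMTriple

end HodgeRepro.Lit2
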